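import Literature.AlgebraicGeometry.Resolution.ArithmeticalThreefoldsLocalProofs
import Mathlib.Algebra.Algebra.Subalgebra.Lattice
import Mathlib.Algebra.Polynomial.Roots
import Mathlib.GroupTheory.SpecificGroups.Cyclic.Basic
import Mathlib.FieldTheory.Fixed
import Mathlib.Algebra.CharP.Algebra
import Mathlib.Algebra.CharP.Lemmas
import Mathlib.RingTheory.LocalRing.ResidueField.Defs
import HarnessLib

/-!
# Cossart–Piltant 2019, the local theorem: the fibre over `m_S` in the Galois case (G)(b)

Topic: `Literature/AlgebraicGeometry/Resolution` (proofs only: no new notions, no named facts).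
Continues `ArithmeticalThreefoldsLocalProofs.lean` towards `CossartPiltant2019Local_holds`
(journal Thm. 1.5 = arXiv v1 Thm. 1.4) along Ch. 2 of the paper, here §2.3 "The Galois or
purely inseparable assumption" (arXiv v1 p. 15):

> "(G) `m = p` is a prime number, `h` is reduced, the ring extension `L|K` is normal and `𝒳`
> is `G`-invariant, where `G := Aut_K(L)`. … (b) `h` is irreducible and Galois over `K` with
> group `G = ℤ/p`",

which is hypothesis (ii) of `CossartPiltant2019Local` (`Aut_K(L)` has order `p` and leaves
`S[x] ⊆ L` stable), and the first two claims of Prop. 2.10 (v1 p. 15):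

> "For `x ∈ Sing 𝒳`, `s := η(x)`, we have: `η⁻¹(s) = {x}`, `k(x) = k(s)` and `δ(x) > 0`."
> Proof: "It can be assumed that `s = m_S`. … By (G), `G` acts transitively on the fiber
> `η⁻¹(s)`. Then `h̄(Z)` is either a `p`-th power or satisfies again (G) w.r.t. the
> zero-dimensional regular local ring `S/m_S`. If `h̄(Z)` satisfies (G), then … `x` is a regular
> point of `𝒳`."

## The argument formalized (for `s = m_S`, or any maximal ideal `𝔞` of `S` of residue characteristic `p`)

Instead of the transitivity of `G` on the fibre we count roots. Since `|G| = p = deg h` and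
`L = K(x)`, the `σ x`, `σ ∈ G`, are `p` distinct roots of `h`, all in `S[x]` by stability, so
`h = ∏_{σ ∈ G} (X - σ x)` in `S[x][X]` (`Polynomial.Monic.map_adjoin_eq_prod_X_sub_C_conj`). Let `Q` be a prime of
`S[x]` over `𝔞` at which `𝒳` is singular, i.e. the corresponding prime `𝔑` of `S[X]` has
`ord_𝔑 h ≥ 2`. By `Polynomial.exists_prime_pow_dvd_map_of_mul_mem_pow` (`ArithmeticalThreefoldsLocalProofs.lean`) the prime factor `π` of `h̄` cut out by
`𝔑` has `π² ∣ h̄`, so the root `x mod Q` of `h̄ = ∏_σ (X - (σ x mod Q))` in the domain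
`S[x]/Q` is a multiple root: `σ x ≡ x mod Q` for some `σ ≠ 1`. Then `σ b ≡ b mod Q` for every
`b = g(x) ∈ S[x]` (`g(σ x) - g(x) ∈ (σ x - x)`), hence for every power of `σ`, i.e. for all of
`G = ⟨σ⟩` (`|G| = p` prime): all `σ x ≡ x mod Q` and `h̄ ≡ (X - x̄)^p = X^p - x̄^p` over
`S[x]/Q`. Comparing coefficients, `h̄ = X^p - c̄` already in `(S/𝔞)[X]`, which is case (c):
`Polynomial.exists_map_eq_X_sub_C_pow_of_purelyInseparable` gives `h̄ = (X - λ)^p`, `λ ∈ S/𝔞`,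
and `𝔑 = (𝔞, X - a)` is the unique point over `𝔞`, rational.

## Content (namespace `Literature.AlgebraicGeometry.Resolution`), all PROVED

* `AlgEquiv.apply_injective_of_adjoin_eq_top`, `Polynomial.Monic.map_eq_prod_X_sub_C_conj`,
  `Polynomial.Monic.map_adjoin_eq_prod_X_sub_C_conj` — `h = ∏_{σ ∈ Aut_K(L)} (X - σ x)` over `L`
  and, under stability, over `S[x]`, when `deg h = |Aut_K(L)|` and `L = K(x)`.
* `AlgEquiv.sub_mem_of_apply_generator_sub_mem`, `AlgEquiv.pow_sub_mem_of_apply_generator_sub_mem`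
  — `σ x ≡ x mod Q ⇒ σⁿ b ≡ b mod Q` for all `b ∈ S[x]`.
* `Polynomial.exists_ne_one_of_X_sub_C_sq_dvd_prod` — a double root of `∏_σ (X - r_σ)` at `r_1`
  is some `r_σ = r_1`, `σ ≠ 1`.
* `Ideal.map_C_le_comap_aeval_of_le_comap`, `Polynomial.mem_comap_aeval_of_aeval_eq_zero` — the
  point `𝔑 = Q ∩ S[X]` of a prime `Q` of `S[x]` over `𝔞` lies over `𝔞` and contains `h`.
* `Polynomial.Monic.exists_map_eq_X_pow_sub_C_of_galois` — under (G)(b), a singular point over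
  `𝔞` forces all `σ x` congruent mod `Q` and `h ≡ X^p - c mod 𝔞` (reduction to case (c));
* `Polynomial.Monic.exists_map_eq_X_sub_C_pow_of_galois` — **Prop. 2.10, first claims, case (b)**:
  then `h ≡ (X - a)^p mod 𝔞` and the singular point is the rational closed point `(𝔞, X - a)`,
  alone in its fibre.
* `Polynomial.Monic.exists_map_eq_X_sub_C_pow_of_hypothesisG` — the same for the data and the
  disjunction "(i) or (ii)" of `CossartPiltant2019Local` verbatim (`S` local with residue
  characteristic `p`): **Prop. 2.10, first claims, under (G)**.

Deliberately NOT here: "`δ(x) > 0`" (third claim of Prop. 2.10) and the stability of (G) under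
permissible blowing ups (its last statement), which need the characteristic polyhedron.

## Sources

* V. Cossart, O. Piltant, *Resolution of singularities of arithmetical threefolds*, J. Algebra
  529 (2019) 268–535 = arXiv:1412.0868, §2.3 assumption (G) and Prop. 2.10 with its proof
  (arXiv v1 pp. 15–16). [CossartPiltant2019]
-/

noncomputable section

open Polynomial Finset IsLocalRing

namespace Literature.AlgebraicGeometry.Resolution

universe u

section GaloisFibre

variable {S : Type u} [CommRing S] {K : Type u} [Field K] [Algebra S K]
  {L : Type u} [Field L] [Algebra K L] [Algebra S L] [IsScalarTower S K L]

/-- The conjugates `σ x`, `σ ∈ Aut_K(L)`, of a generator `x` of `L = K(x)` are pairwise distinct.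
[folklore] -/
theorem AlgEquiv.apply_injective_of_adjoin_eq_top {x : L}
    (hx : Algebra.adjoin K ({x} : Set L) = ⊤) :
    Function.Injective fun σ : L ≃ₐ[K] L => σ x := by
  intro σ τ hστ
  apply AlgEquiv.coe_toAlgHom_injective
  exact AlgHom.ext_of_adjoin_eq_top hx fun y hy => by
    rw [Set.mem_singleton_iff] at hy
    subst hy
    exact hστ

/-- **`h = ∏_{σ ∈ G} (X - σ x)` over `L`**: if `h ∈ S[X]` is monic of degree `p = |Aut_K(L)|`
with root `x` generating `L = K(x)`, then the `p` distinct conjugates `σ x` are all the roots of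
`h` and `h = ∏_σ (X - σ x)`. [folklore] -/
theorem Polynomial.Monic.map_eq_prod_X_sub_C_conj [Fintype (L ≃ₐ[K] L)] {h : S[X]} (hh : h.Monic)
    {x : L} (hx : aeval x h = 0) (hKx : Algebra.adjoin K ({x} : Set L) = ⊤)
    (hcard : Fintype.card (L ≃ₐ[K] L) = h.natDegree) :
    h.map (algebraMap S L) = ∏ σ : L ≃ₐ[K] L, (X - C (σ x)) := by
  classical
  have hhL : (h.map (algebraMap S L)).Monic := hh.map _
  have hne : h.map (algebraMap S L) ≠ 0 := hhL.ne_zero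
  -- every `σ x` is a root
  have hroot : ∀ σ : L ≃ₐ[K] L, (h.map (algebraMap S L)).IsRoot (σ x) := by
    intro σ
    rw [IsRoot, eval_map_algebraMap]
    have : aeval (σ x) h = σ (aeval x h) :=
      aeval_algHom_apply ((σ : L →ₐ[K] L).restrictScalars S) x h
    rw [this, hx, map_zero]
  -- the multiset of conjugates is contained in the roots
  set s : Multiset L := (Finset.univ : Finset (L ≃ₐ[K] L)).val.map fun σ => σ x with hs
  have hsnodup : s.Nodup :=
    (Finset.univ : Finset (L ≃ₐ[K] L)).nodup.map (AlgEquiv.apply_injective_of_adjoin_eq_top hKx)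
  have hsle : s ≤ (h.map (algebraMap S L)).roots := by
    rw [Multiset.le_iff_subset hsnodup]
    intro y hy
    obtain ⟨σ, -, rfl⟩ := Multiset.mem_map.mp hy
    exact (mem_roots hne).mpr (hroot σ)
  have hdvd : (s.map fun a => X - C a).prod ∣ h.map (algebraMap S L) :=
    (Multiset.prod_X_sub_C_dvd_iff_le_roots hne s).mpr hsle
  have hprod : (s.map fun a => X - C a).prod = ∏ σ : L ≃ₐ[K] L, (X - C (σ x)) := by
    rw [hs, Multiset.map_map]
    rfl
  rw [hprod] at hdvd
  have hmonic : (∏ σ : L ≃ₐ[K] L, (X - C (σ x))).Monic :=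
    monic_prod_of_monic _ _ fun σ _ => monic_X_sub_C (σ x)
  refine eq_of_monic_of_dvd_of_natDegree_le hmonic hhL hdvd ?_
  rw [natDegree_prod_of_monic _ _ fun σ _ => monic_X_sub_C (σ x)]
  simp only [natDegree_X_sub_C, Finset.sum_const, Finset.card_univ, smul_eq_mul, mul_one]
  rw [hh.natDegree_map, hcard]


/-- The same factorisation **inside `S[x]`**: under the stability hypothesis
`σ(S[x]) ⊆ S[x]` of (G)(b), `h = ∏_{σ ∈ G} (X - σ x)` in `S[x][X]`.
[cite: CossartPiltant2019, §2.3 (G)(b) (arXiv v1 p. 15)] -/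
theorem Polynomial.Monic.map_adjoin_eq_prod_X_sub_C_conj [Fintype (L ≃ₐ[K] L)] {h : S[X]}
    (hh : h.Monic) {x : L} (hx : aeval x h = 0) (hKx : Algebra.adjoin K ({x} : Set L) = ⊤)
    (hcard : Fintype.card (L ≃ₐ[K] L) = h.natDegree)
    (hstab : ∀ σ : L ≃ₐ[K] L, ∀ y ∈ Algebra.adjoin S ({x} : Set L),
      σ y ∈ Algebra.adjoin S ({x} : Set L)) :
    h.map (algebraMap S (Algebra.adjoin S ({x} : Set L))) =
      ∏ σ : L ≃ₐ[K] L, (X - C (⟨σ x, hstab σ x (Algebra.self_mem_adjoin_singleton S x)⟩ :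
        Algebra.adjoin S ({x} : Set L))) := by
  apply map_injective ((Algebra.adjoin S ({x} : Set L)).val : _ →+* L) Subtype.val_injective
  rw [Polynomial.map_map]
  have hcomp : ((Algebra.adjoin S ({x} : Set L)).val : _ →+* L).comp
      (algebraMap S (Algebra.adjoin S ({x} : Set L))) = algebraMap S L := by
    ext s
    simp
  rw [hcomp, Polynomial.Monic.map_eq_prod_X_sub_C_conj hh hx hKx hcard, Polynomial.map_prod]
  refine Finset.prod_congr rfl fun σ _ => ?_
  simp

/-- **`σ x ≡ x mod Q` propagates to all of `S[x]`**: if `σ` leaves `S[x]` stable and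
`σ x - x ∈ Q` for an ideal `Q` of `S[x]`, then `σ b - b ∈ Q` for every `b ∈ S[x]`
(`b = g(x)`, and `g(σ x) - g(x) ∈ (σ x - x) S[x]`). [folklore] -/
theorem AlgEquiv.sub_mem_of_apply_generator_sub_mem {x : L} (σ : L ≃ₐ[K] L)
    (hstab : ∀ y ∈ Algebra.adjoin S ({x} : Set L), σ y ∈ Algebra.adjoin S ({x} : Set L))
    (Q : Ideal (Algebra.adjoin S ({x} : Set L)))
    (hσx : (⟨σ x, hstab x (Algebra.self_mem_adjoin_singleton S x)⟩ : Algebra.adjoin S ({x} : Set L)) -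
      ⟨x, Algebra.self_mem_adjoin_singleton S x⟩ ∈ Q)
    (b : Algebra.adjoin S ({x} : Set L)) :
    (⟨σ b, hstab b b.2⟩ : Algebra.adjoin S ({x} : Set L)) - b ∈ Q := by
  -- `b = g(x)` for some `g ∈ S[X]`
  have hbmem : (b : L) ∈ (aeval x : S[X] →ₐ[S] L).range := by
    rw [← Algebra.adjoin_singleton_eq_range_aeval]
    exact b.2
  obtain ⟨g, hg⟩ := hbmem
  change aeval x g = (b : L) at hg
  -- in `S[x]`: `b = g(x)` and `σ b = g(σ x)`
  have hb : b = aeval (⟨x, Algebra.self_mem_adjoin_singleton S x⟩ : Algebra.adjoin S ({x} : Set L))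
      g := by
    apply Subtype.ext
    rw [aeval_subalgebra_coe]
    exact hg.symm
  have hσb : (⟨σ b, hstab b b.2⟩ : Algebra.adjoin S ({x} : Set L)) =
      aeval (⟨σ x, hstab x (Algebra.self_mem_adjoin_singleton S x)⟩ :
        Algebra.adjoin S ({x} : Set L)) g := by
    apply Subtype.ext
    rw [aeval_subalgebra_coe]
    change σ (b : L) = aeval (σ x) g
    rw [← hg]
    exact (aeval_algHom_apply ((σ : L →ₐ[K] L).restrictScalars S) x g).symm
  rw [hσb, hb, aeval_def, aeval_def, eval₂_eq_eval_map, eval₂_eq_eval_map]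
  obtain ⟨c, hc⟩ := sub_dvd_eval_sub
    (⟨σ x, hstab x (Algebra.self_mem_adjoin_singleton S x)⟩ : Algebra.adjoin S ({x} : Set L))
    ⟨x, Algebra.self_mem_adjoin_singleton S x⟩ (g.map (algebraMap S (Algebra.adjoin S ({x} : Set L))))
  rw [hc]
  exact Ideal.mul_mem_right _ _ hσx

/-- … hence to all powers of `σ`: `σⁿ b ≡ b mod Q` for all `b ∈ S[x]`. [folklore] -/
theorem AlgEquiv.pow_sub_mem_of_apply_generator_sub_mem {x : L} (σ : L ≃ₐ[K] L)
    (hstab : ∀ τ : L ≃ₐ[K] L, ∀ y ∈ Algebra.adjoin S ({x} : Set L),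
      τ y ∈ Algebra.adjoin S ({x} : Set L))
    (Q : Ideal (Algebra.adjoin S ({x} : Set L)))
    (hσx : (⟨σ x, hstab σ x (Algebra.self_mem_adjoin_singleton S x)⟩ :
        Algebra.adjoin S ({x} : Set L)) - ⟨x, Algebra.self_mem_adjoin_singleton S x⟩ ∈ Q)
    (n : ℕ) (b : Algebra.adjoin S ({x} : Set L)) :
    (⟨(σ ^ n) b, hstab (σ ^ n) b b.2⟩ : Algebra.adjoin S ({x} : Set L)) - b ∈ Q := by
  induction n with
  | zero => simp
  | succ n ih =>
    have hstep := AlgEquiv.sub_mem_of_apply_generator_sub_mem σ (hstab σ) Q hσx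
      ⟨(σ ^ n) b, hstab (σ ^ n) b b.2⟩
    have heq : (⟨(σ ^ (n + 1)) b, hstab (σ ^ (n + 1)) b b.2⟩ : Algebra.adjoin S ({x} : Set L)) =
        ⟨σ ((σ ^ n) b), hstab σ _ (hstab (σ ^ n) b b.2)⟩ := by
      apply Subtype.ext
      change (σ ^ (n + 1)) (b : L) = σ ((σ ^ n) (b : L))
      rw [pow_succ', AlgEquiv.mul_apply]
    rw [heq]
    have : (⟨σ ((σ ^ n) b), hstab σ _ (hstab (σ ^ n) b b.2)⟩ : Algebra.adjoin S ({x} : Set L)) - b =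
        ((⟨σ ((σ ^ n) b), hstab σ _ (hstab (σ ^ n) b b.2)⟩ : Algebra.adjoin S ({x} : Set L)) -
          ⟨(σ ^ n) b, hstab (σ ^ n) b b.2⟩) +
        ((⟨(σ ^ n) b, hstab (σ ^ n) b b.2⟩ : Algebra.adjoin S ({x} : Set L)) - b) := by ring
    rw [this]
    exact Ideal.add_mem _ hstep ih

/-- **A multiple root of `∏_σ (X - r_σ)` at `r_1`** means `r_σ = r_1` for some `σ ≠ 1` (over a
domain). [folklore] -/
theorem Polynomial.exists_ne_one_of_X_sub_C_sq_dvd_prod {D : Type*} [CommRing D] [IsDomain D]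
    {G : Type*} [Group G] [Fintype G] [DecidableEq G] (r : G → D)
    (hdvd : (X - C (r 1)) ^ 2 ∣ ∏ σ : G, (X - C (r σ))) : ∃ σ : G, σ ≠ 1 ∧ r σ = r 1 := by
  rw [← Finset.mul_prod_erase Finset.univ (fun σ => X - C (r σ)) (Finset.mem_univ 1), pow_two,
    mul_dvd_mul_iff_left (X_sub_C_ne_zero (r 1)), dvd_iff_isRoot, IsRoot, eval_prod,
    Finset.prod_eq_zero_iff] at hdvd
  obtain ⟨σ, hσ, hσr⟩ := hdvd
  rw [Finset.mem_erase] at hσ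
  rw [eval_sub, eval_X, eval_C, sub_eq_zero] at hσr
  exact ⟨σ, hσ.1, hσr.symm⟩

/-- The point `𝔑 = Q ∩ S[X]` (preimage under `X ↦ x`) of a prime `Q` of `S[x]` over `𝔞` lies
over `𝔞`: `𝔞 S[X] ⊆ 𝔑`. [folklore] -/
theorem Ideal.map_C_le_comap_aeval_of_le_comap {x : L} {𝔞 : Ideal S}
    (Q : Ideal (Algebra.adjoin S ({x} : Set L)))
    (h𝔞Q : 𝔞 ≤ Q.comap (algebraMap S (Algebra.adjoin S ({x} : Set L)))) :
    𝔞.map (C : S →+* S[X]) ≤ Q.comap (aeval (⟨x, Algebra.self_mem_adjoin_singleton S x⟩ :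
      Algebra.adjoin S ({x} : Set L))).toRingHom := by
  rw [Ideal.map_le_iff_le_comap]
  intro a ha
  change aeval (⟨x, Algebra.self_mem_adjoin_singleton S x⟩ : Algebra.adjoin S ({x} : Set L))
    (C a) ∈ Q
  rw [aeval_C]
  exact h𝔞Q ha

/-- … and contains `h` when `h(x) = 0`. [folklore] -/
theorem Polynomial.mem_comap_aeval_of_aeval_eq_zero {x : L} {h : S[X]} (hx : aeval x h = 0)
    (Q : Ideal (Algebra.adjoin S ({x} : Set L))) :
    h ∈ Q.comap (aeval (⟨x, Algebra.self_mem_adjoin_singleton S x⟩ :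
      Algebra.adjoin S ({x} : Set L))).toRingHom := by
  have hhB : aeval (⟨x, Algebra.self_mem_adjoin_singleton S x⟩ : Algebra.adjoin S ({x} : Set L))
      h = 0 := by
    apply Subtype.ext
    rw [aeval_subalgebra_coe]
    exact hx
  change aeval (⟨x, Algebra.self_mem_adjoin_singleton S x⟩ : Algebra.adjoin S ({x} : Set L)) h ∈ Q
  rw [hhB]
  exact Q.zero_mem

/-- **Prop. 2.10 in case (b) of (G), reduction to case (c)** (Cossart–Piltant 2019, v1 p. 15,
proof of Prop. 2.10: "By (G), `G` acts transitively on the fiber `η⁻¹(s)`. Then `h̄(Z)` is either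
a `p`-th power or satisfies again (G)"): let `h ∈ S[X]` be monic of prime degree `p` with root
`x` generating `L = K(x)` over a field `K ⊇ S`, `|Aut_K(L)| = p` and `S[x]` stable under
`Aut_K(L)` (hypothesis (ii) of `CossartPiltant2019Local`); let `𝔞` be a maximal ideal of `S`
with `char S/𝔞 = p` and `Q` a prime of `S[x]` over `𝔞` such that, at the corresponding point
`𝔑` of `Spec S[X]`, `ord_𝔑 h ≥ 2` (`s h ∈ 𝔑²`, `s ∉ 𝔑`). Then all conjugates `σ x` are
congruent modulo `Q` and `h ≡ X^p - c mod 𝔞` for some `c ∈ S` — the purely inseparable shape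
of case (c). [cite: CossartPiltant2019, Prop. 2.10 (proof) (arXiv v1 p. 15)] -/
theorem Polynomial.Monic.exists_map_eq_X_pow_sub_C_of_galois {p : ℕ} (hp : p.Prime)
    {𝔞 : Ideal S} (h𝔞 : 𝔞.IsMaximal) [CharP (S ⧸ 𝔞) p] {h : S[X]} (hh : h.Monic)
    (hdeg : h.natDegree = p) {x : L} (hx : aeval x h = 0)
    (hKx : Algebra.adjoin K ({x} : Set L) = ⊤) (hcard : Nat.card (L ≃ₐ[K] L) = p)
    (hstab : ∀ σ : L ≃ₐ[K] L, ∀ y ∈ Algebra.adjoin S ({x} : Set L),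
      σ y ∈ Algebra.adjoin S ({x} : Set L))
    (Q : Ideal (Algebra.adjoin S ({x} : Set L))) [hQ : Q.IsPrime]
    (h𝔞Q : 𝔞 ≤ Q.comap (algebraMap S (Algebra.adjoin S ({x} : Set L))))
    {s : S[X]}
    (hs : s ∉ Q.comap (aeval (⟨x, Algebra.self_mem_adjoin_singleton S x⟩ :
      Algebra.adjoin S ({x} : Set L))).toRingHom)
    (hsh : s * h ∈ Q.comap (aeval (⟨x, Algebra.self_mem_adjoin_singleton S x⟩ :
      Algebra.adjoin S ({x} : Set L))).toRingHom ^ 2) :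
    (∀ σ : L ≃ₐ[K] L, (⟨σ x, hstab σ x (Algebra.self_mem_adjoin_singleton S x)⟩ :
        Algebra.adjoin S ({x} : Set L)) - ⟨x, Algebra.self_mem_adjoin_singleton S x⟩ ∈ Q) ∧
      ∃ c : S, h.map (Ideal.Quotient.mk 𝔞) = X ^ p - C (Ideal.Quotient.mk 𝔞 c) := by
  classical
  -- notation-free abbreviations
  let B : Subalgebra S L := Algebra.adjoin S ({x} : Set L)
  let xB : B := ⟨x, Algebra.self_mem_adjoin_singleton S x⟩
  let cj : (L ≃ₐ[K] L) → B := fun σ => ⟨σ x, hstab σ x (Algebra.self_mem_adjoin_singleton S x)⟩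
  let 𝔑 : Ideal S[X] := Q.comap (aeval xB).toRingHom
  letI := Ideal.Quotient.field 𝔞
  haveI : Fact p.Prime := ⟨hp⟩
  haveI : Finite (L ≃ₐ[K] L) := Nat.finite_of_card_ne_zero (hcard ▸ hp.ne_zero)
  letI : Fintype (L ≃ₐ[K] L) := Fintype.ofFinite _
  have hcardF : Fintype.card (L ≃ₐ[K] L) = h.natDegree := by
    rw [hdeg, ← hcard, Nat.card_eq_fintype_card]
  -- the point `𝔑` of `Spec S[X]` and its basic properties
  haveI h𝔑 : 𝔑.IsPrime := Ideal.comap_isPrime _ Q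
  have h𝔞𝔑 : 𝔞.map (C : S →+* S[X]) ≤ 𝔑 := Ideal.map_C_le_comap_aeval_of_le_comap Q h𝔞Q
  have hh𝔑 : h ∈ 𝔑 := Polynomial.mem_comap_aeval_of_aeval_eq_zero hx Q
  have h𝔑ne : 𝔑 ≠ 𝔞.map (C : S →+* S[X]) := by
    intro heq
    have : h.map (Ideal.Quotient.mk 𝔞) = 0 := by
      rw [← coe_mapRingHom, ← RingHom.mem_ker, ker_mapRingHom, Ideal.mk_ker, ← heq]
      exact hh𝔑
    exact (hh.map (Ideal.Quotient.mk 𝔞)).ne_zero this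
  -- `π² ∣ h̄` for the prime factor `π` of `h̄` cut out by `𝔑`
  obtain ⟨π, hπ, h𝔑π, hπh⟩ :=
    Polynomial.exists_prime_pow_dvd_map_of_mul_mem_pow h𝔞 h𝔞𝔑 h𝔑ne hs hsh
  -- the residue map `ι : S/𝔞 → S[x]/Q` and the roots `r σ = σ x mod Q`
  let ι : S ⧸ 𝔞 →+* B ⧸ Q := Ideal.quotientMap Q (algebraMap S B) h𝔞Q
  have hι : Function.Injective ι := ι.injective
  let r : (L ≃ₐ[K] L) → B ⧸ Q := fun σ => Ideal.Quotient.mk Q (cj σ)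
  have hr1 : r 1 = Ideal.Quotient.mk Q xB := rfl
  -- `h̄ ↦ ∏_σ (X - r σ)` under `ι`
  have hfac : (h.map (Ideal.Quotient.mk 𝔞)).map ι = ∏ σ : L ≃ₐ[K] L, (X - C (r σ)) := by
    have h1 : (h.map (Ideal.Quotient.mk 𝔞)).map ι =
        (h.map (algebraMap S B)).map (Ideal.Quotient.mk Q) := by
      rw [Polynomial.map_map, Polynomial.map_map, Ideal.quotientMap_comp_mk]
    rw [h1, Polynomial.Monic.map_adjoin_eq_prod_X_sub_C_conj hh hx hKx hcardF hstab,
      Polynomial.map_prod]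
    refine Finset.prod_congr rfl fun σ _ => ?_
    rw [Polynomial.map_sub, map_X, map_C]
  -- `π ↦` a polynomial vanishing at `r 1`
  have hπroot : (π.map ι).IsRoot (r 1) := by
    let ψ : S[X] →+* B ⧸ Q := (Ideal.Quotient.mk Q).comp (aeval xB).toRingHom
    let χ : (S ⧸ 𝔞)[X] →+* B ⧸ Q := eval₂RingHom ι (r 1)
    have hχφ : χ.comp (mapRingHom (Ideal.Quotient.mk 𝔞)) = ψ := by
      refine Polynomial.ringHom_ext (fun a => ?_) ?_
      · change χ ((C a).map (Ideal.Quotient.mk 𝔞)) = Ideal.Quotient.mk Q (aeval xB (C a))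
        rw [map_C, aeval_C]
        change eval₂ ι (r 1) (C (Ideal.Quotient.mk 𝔞 a)) = _
        rw [eval₂_C]
        exact Ideal.quotientMap_mk
      · change χ ((X : S[X]).map (Ideal.Quotient.mk 𝔞)) = Ideal.Quotient.mk Q (aeval xB X)
        rw [map_X, aeval_X]
        change eval₂ ι (r 1) X = _
        rw [eval₂_X]
        rfl
    obtain ⟨πl, hπl⟩ := map_surjective (Ideal.Quotient.mk 𝔞) Ideal.Quotient.mk_surjective π
    have hπl𝔑 : πl ∈ 𝔑 := by
      rw [h𝔑π, Ideal.mem_comap, coe_mapRingHom, hπl]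
      exact Ideal.mem_span_singleton_self π
    have hψ : ψ πl = 0 := by
      change Ideal.Quotient.mk Q (aeval xB πl) = 0
      exact Ideal.Quotient.eq_zero_iff_mem.mpr hπl𝔑
    rw [IsRoot, ← eval₂_eq_eval_map]
    change χ π = 0
    rw [← hπl, ← coe_mapRingHom]
    change (χ.comp (mapRingHom (Ideal.Quotient.mk 𝔞))) πl = 0
    rw [hχφ, hψ]
  -- so `r 1` is a multiple root of `∏_σ (X - r σ)`
  have hsq : (X - C (r 1)) ^ 2 ∣ ∏ σ : L ≃ₐ[K] L, (X - C (r σ)) := by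
    rw [← hfac]
    have h2 : (π.map ι) ^ 2 ∣ (h.map (Ideal.Quotient.mk 𝔞)).map ι := by
      rw [← Polynomial.map_pow]
      exact map_dvd ι hπh
    exact (pow_dvd_pow_of_dvd (dvd_iff_isRoot.mpr hπroot) 2).trans h2
  obtain ⟨σ, hσ1, hσr⟩ := Polynomial.exists_ne_one_of_X_sub_C_sq_dvd_prod r hsq
  -- `σ x ≡ x`, hence `τ x ≡ x` for every `τ ∈ ⟨σ⟩ = G`
  have hσx : cj σ - xB ∈ Q := by
    rw [← Ideal.Quotient.eq]
    exact hσr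
  have hall : ∀ τ : L ≃ₐ[K] L, cj τ - xB ∈ Q := by
    intro τ
    obtain ⟨n, rfl⟩ := mem_powers_of_prime_card hcard hσ1 (g' := τ)
    exact AlgEquiv.pow_sub_mem_of_apply_generator_sub_mem σ hstab Q hσx n xB
  refine ⟨hall, ?_⟩
  -- `h̄ ↦ (X - r 1)^p = X^p - (r 1)^p`
  haveI : CharP (B ⧸ Q) p := charP_of_injective_ringHom hι p
  have hpow : (h.map (Ideal.Quotient.mk 𝔞)).map ι = X ^ p - C (r 1 ^ p) := by
    rw [hfac]
    have : ∀ τ ∈ (Finset.univ : Finset (L ≃ₐ[K] L)), X - C (r τ) = X - C (r 1) := by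
      intro τ _
      rw [hr1, sub_right_inj, C_inj, Ideal.Quotient.eq]
      exact hall τ
    rw [Finset.prod_congr rfl this, Finset.prod_const, Finset.card_univ, hcardF, hdeg]
    have key := sub_pow_char (R := (B ⧸ Q)[X]) (X : (B ⧸ Q)[X]) (C (r 1))
    rw [key, ← C_pow]
  -- descend to `S/𝔞` by comparing coefficients along the injection `ι`
  obtain ⟨c, hc⟩ := Ideal.Quotient.mk_surjective (-(h.map (Ideal.Quotient.mk 𝔞)).coeff 0)
  refine ⟨c, map_injective ι hι ?_⟩
  rw [hpow, Polynomial.map_sub, Polynomial.map_pow, map_X, map_C, hc, map_neg]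
  congr 2
  have h0 := congrArg (fun q : (B ⧸ Q)[X] => q.coeff 0) hpow
  simp only [coeff_map, coeff_sub, coeff_X_pow, coeff_C_zero, if_neg (Ne.symm hp.ne_zero),
    zero_sub] at h0
  rw [coeff_map, h0, neg_neg]

/-- **Prop. 2.10, first claims, under (G)(b)** (Cossart–Piltant 2019, v1 p. 15: "For
`x ∈ Sing 𝒳`, `s := η(x)`, we have: `η⁻¹(s) = {x}`, `k(x) = k(s)`"; here `s = m_S`, or any
maximal ideal `𝔞` of `S` of residue characteristic `p`): in the setting of hypothesis (ii) of
`CossartPiltant2019Local` (`h` monic of prime degree `p`, `L = K(x)`, `|Aut_K(L)| = p`, `S[x]`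
stable), if `𝒳 = Spec S[x]` has a singular point `Q` over `𝔞` — `ord_𝔑 h ≥ 2` at the
corresponding point `𝔑` of `Spec S[X]` — then `h ≡ (X - a)^p mod 𝔞` for some `a ∈ S` and `𝔑` is
the rational closed point `(𝔞, X - a)`, the ONLY point of `Spec S[X] ⊇ 𝒳` over `𝔞` containing
`h` (`Polynomial.eq_sup_span_X_sub_C_of_map_eq_X_sub_C_pow`).
[cite: CossartPiltant2019, Prop. 2.10 (arXiv v1 pp. 15–16)] -/
theorem Polynomial.Monic.exists_map_eq_X_sub_C_pow_of_galois {p : ℕ} (hp : p.Prime)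
    {𝔞 : Ideal S} (h𝔞 : 𝔞.IsMaximal) [CharP (S ⧸ 𝔞) p] {h : S[X]} (hh : h.Monic)
    (hdeg : h.natDegree = p) {x : L} (hx : aeval x h = 0)
    (hKx : Algebra.adjoin K ({x} : Set L) = ⊤) (hcard : Nat.card (L ≃ₐ[K] L) = p)
    (hstab : ∀ σ : L ≃ₐ[K] L, ∀ y ∈ Algebra.adjoin S ({x} : Set L),
      σ y ∈ Algebra.adjoin S ({x} : Set L))
    (Q : Ideal (Algebra.adjoin S ({x} : Set L))) [hQ : Q.IsPrime]
    (h𝔞Q : 𝔞 ≤ Q.comap (algebraMap S (Algebra.adjoin S ({x} : Set L))))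
    {s : S[X]}
    (hs : s ∉ Q.comap (aeval (⟨x, Algebra.self_mem_adjoin_singleton S x⟩ :
      Algebra.adjoin S ({x} : Set L))).toRingHom)
    (hsh : s * h ∈ Q.comap (aeval (⟨x, Algebra.self_mem_adjoin_singleton S x⟩ :
      Algebra.adjoin S ({x} : Set L))).toRingHom ^ 2) :
    ∃ a : S, h.map (Ideal.Quotient.mk 𝔞) = (X - C (Ideal.Quotient.mk 𝔞 a)) ^ p ∧
      Q.comap (aeval (⟨x, Algebra.self_mem_adjoin_singleton S x⟩ :
        Algebra.adjoin S ({x} : Set L))).toRingHom =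
        𝔞.map (C : S →+* S[X]) ⊔ Ideal.span {X - C a} := by
  obtain ⟨-, c, hc⟩ := Polynomial.Monic.exists_map_eq_X_pow_sub_C_of_galois hp h𝔞 hh hdeg hx
    hKx hcard hstab Q h𝔞Q hs hsh
  haveI : (Q.comap (aeval (R := S) (⟨x, Algebra.self_mem_adjoin_singleton S x⟩ :
      Algebra.adjoin S ({x} : Set L))).toRingHom).IsPrime := Ideal.comap_isPrime _ Q
  exact Polynomial.exists_map_eq_X_sub_C_pow_of_purelyInseparable h𝔞 hp hc
    (Ideal.map_C_le_comap_aeval_of_le_comap Q h𝔞Q)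
    (Polynomial.mem_comap_aeval_of_aeval_eq_zero hx Q) hs hsh

/-- **Prop. 2.10, first claims, for the data of `CossartPiltant2019Local`** (Cossart–Piltant
2019, v1 p. 15): let `S` be a local ring with residue field of prime characteristic `p`, `K ⊇ S`
a field, `h ∈ S[X]` monic of degree `p` with a root `x` generating the field `L = K(x)`, and assume
hypothesis (i) (`char K = p`, `f_{1,X} = ⋯ = f_{p-1,X} = 0`) or (ii) (`|Aut_K(L)| = p` and `S[x]`
stable) of `CossartPiltant2019Local` — i.e. assumption (G), cases (c)/(b). If `𝒳 = Spec S[x]` is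
singular at a point `Q` over `m_S` (`ord_𝔑 h ≥ 2` at the corresponding point `𝔑` of `Spec S[X]`:
`s h ∈ 𝔑²` for some `s ∉ 𝔑`), then `h ≡ (X - a)^p mod m_S` for some `a ∈ S`, and `𝔑 = (m_S, X - a)`
is the rational closed point, the only point of `Spec S[X]` over `m_S` containing `h`
("`η⁻¹(s) = {x}`, `k(x) = k(s)`"). [cite: CossartPiltant2019, Prop. 2.10 (arXiv v1 pp. 15–16)] -/
theorem Polynomial.Monic.exists_map_eq_X_sub_C_pow_of_hypothesisG [IsLocalRing S] {p : ℕ}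
    (hp : p.Prime) [CharP (IsLocalRing.ResidueField S) p] {h : S[X]} (hh : h.Monic)
    (hdeg : h.natDegree = p) {x : L} (hx : aeval x h = 0)
    (hKx : Algebra.adjoin K ({x} : Set L) = ⊤)
    (hG : (CharP K p ∧ ∀ i, 0 < i → i < p → h.coeff i = 0) ∨
      (Nat.card (L ≃ₐ[K] L) = p ∧
        ∀ σ : L ≃ₐ[K] L, ∀ y ∈ Algebra.adjoin S ({x} : Set L),
          σ y ∈ Algebra.adjoin S ({x} : Set L)))
    (Q : Ideal (Algebra.adjoin S ({x} : Set L))) [hQ : Q.IsPrime]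
    (h𝔞Q : IsLocalRing.maximalIdeal S ≤ Q.comap (algebraMap S (Algebra.adjoin S ({x} : Set L))))
    {s : S[X]}
    (hs : s ∉ Q.comap (aeval (⟨x, Algebra.self_mem_adjoin_singleton S x⟩ :
      Algebra.adjoin S ({x} : Set L))).toRingHom)
    (hsh : s * h ∈ Q.comap (aeval (⟨x, Algebra.self_mem_adjoin_singleton S x⟩ :
      Algebra.adjoin S ({x} : Set L))).toRingHom ^ 2) :
    ∃ a : S, h.map (Ideal.Quotient.mk (IsLocalRing.maximalIdeal S)) =
        (X - C (Ideal.Quotient.mk (IsLocalRing.maximalIdeal S) a)) ^ p ∧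
      Q.comap (aeval (⟨x, Algebra.self_mem_adjoin_singleton S x⟩ :
        Algebra.adjoin S ({x} : Set L))).toRingHom =
        (IsLocalRing.maximalIdeal S).map (C : S →+* S[X]) ⊔ Ideal.span {X - C a} := by
  haveI : CharP (S ⧸ IsLocalRing.maximalIdeal S) p := ‹CharP (IsLocalRing.ResidueField S) p›
  have h𝔞 : (IsLocalRing.maximalIdeal S).IsMaximal := IsLocalRing.maximalIdeal.isMaximal S
  rcases hG with ⟨-, hcoeff⟩ | ⟨hcard, hstab⟩
  · -- case (c): `h̄ = X^p + f̄_p = X^p - (-f̄_p)`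
    have hhc : h.map (Ideal.Quotient.mk (IsLocalRing.maximalIdeal S)) =
        X ^ p - C (Ideal.Quotient.mk (IsLocalRing.maximalIdeal S) (-h.coeff 0)) := by
      ext i
      rw [coeff_map, coeff_sub, coeff_X_pow, coeff_C]
      rcases Nat.lt_trichotomy i p with hi | rfl | hi
      · rcases Nat.eq_zero_or_pos i with rfl | hi0
        · rw [if_neg (Ne.symm hp.ne_zero), if_pos rfl, map_neg, zero_sub, neg_neg]
        · rw [hcoeff i hi0 hi, if_neg hi.ne, if_neg hi0.ne', map_zero, sub_zero]
      · have : h.coeff h.natDegree = 1 := hh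
        rw [hdeg] at this
        rw [this, map_one, if_pos rfl, if_neg hp.ne_zero, sub_zero]
      · have : h.coeff i = 0 := by
          apply coeff_eq_zero_of_natDegree_lt
          omega
        rw [this, map_zero, if_neg hi.ne', if_neg (by omega), sub_zero]
    haveI : (Q.comap (aeval (R := S) (⟨x, Algebra.self_mem_adjoin_singleton S x⟩ :
        Algebra.adjoin S ({x} : Set L))).toRingHom).IsPrime := Ideal.comap_isPrime _ Q
    exact Polynomial.exists_map_eq_X_sub_C_pow_of_purelyInseparable h𝔞 hp hhc
      (Ideal.map_C_le_comap_aeval_of_le_comap Q h𝔞Q)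
      (Polynomial.mem_comap_aeval_of_aeval_eq_zero hx Q) hs hsh
  · -- case (b)
    exact Polynomial.Monic.exists_map_eq_X_sub_C_pow_of_galois hp h𝔞 hh hdeg hx hKx hcard hstab
      Q h𝔞Q hs hsh

end GaloisFibre

end Literature.AlgebraicGeometry.Resolution

end
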